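import Mathlib
import Literature.Computability.Complexity.NullstellensatzRefutation
import Literature.Computability.AlgebraicComplexity.StandardFamilies
import Summits.ValiantsHypothesis.ValiantsHypothesis.Theorems.RefutationDegreeCertWindowQPCoeffDegree

/-!
# From ideal membership to a Nullstellensatz refutation — line `Sketch` (v2) of crux
`CertWindowQP` (stmt-ValiantsHypothesis-5640)

Stub `stub_nsOfPowMem` of the registered skeleton. Notation: the axioms of `Rep(n,m)` are the
`x`-coefficients `eqn_μ = P_μ - c_μ` of `det(A₀ + ∑ₑ xₑ Aₑ) - per_n`, where `P_μ` (a polynomial in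
the `N` unknown entries `a`, homogeneous of degree `m`) is the `μ`-th coefficient of the generic
pencil determinant and `c_μ ∈ ℂ` the `μ`-th coefficient of `per_n`. Homogenise the unknowns with a
fresh variable `T` (the variable `none` of `MvPolynomial (Option _) ℂ`, the old ones embedded by
`rename some`): `G_μ := P_μ - c_μ T^m` is homogeneous of degree `m`.

**Claim.** If `(T^m)^(N+1) ∈ (G_μ)_μ` then `{eqn_μ}` has a Nullstellensatz refutation with every
product of total degree `≤ (N+1)·m`.

Proof (Mathlib only):
1. unpack the membership into an identity `∑_μ H_μ G_μ = T^(mN+m)`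
   (`Finsupp.mem_ideal_span_range_iff_exists_finsupp`);
2. take homogeneous components of degree `mN + m`: since `G_μ` is homogeneous of degree `m`,
   `homogeneousComponent (k + m) (H_μ G_μ) = homogeneousComponent k H_μ · G_μ`
   (`certWindowQP_homogeneousComponent_mul`), so WLOG every `H_μ` is homogeneous of degree `mN`;
3. dehomogenise with the algebra map `T ↦ 1`, `some v ↦ X v` (`MvPolynomial.aeval`): it sends
   `G_μ ↦ P_μ - c_μ = eqn_μ`, `T^(mN+m) ↦ 1`, and does not raise total degrees
   (`certWindowQP_totalDegree_aeval_le`), so the images `h_μ` of the `H_μ` have degree `≤ mN` and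
   every product `h_μ · eqn_μ` has degree `≤ mN + m = (N+1)·m`.
-/

open MvPolynomial

namespace Summit.ValiantsHypothesis.ValiantsHypothesis.Theorems

set_option linter.dupNamespace false

open Literature.Computability.AlgebraicComplexity Literature.Computability.Complexity

section Helpers

variable {σ τ R : Type*} [CommRing R]

/-- Multiplying by a homogeneous polynomial `g` of degree `d` shifts homogeneous components:
the degree-`(k + d)` component of `h * g` is `(degree-k component of h) * g`. -/
private theorem certWindowQP_homogeneousComponent_mul {h g : MvPolynomial σ R} {d : ℕ}
    (hg : g.IsHomogeneous d) (k : ℕ) :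
    homogeneousComponent (k + d) (h * g) = homogeneousComponent k h * g := by
  classical
  have hterm : ∀ j, homogeneousComponent (k + d) (homogeneousComponent j h * g) =
      if j = k then homogeneousComponent k h * g else 0 := by
    intro j
    rw [homogeneousComponent_of_mem ((homogeneousComponent_isHomogeneous j h).mul hg)]
    by_cases hjk : j = k
    · subst hjk
      simp
    · rw [if_neg (fun e => hjk (Nat.add_right_cancel e).symm), if_neg hjk]
  conv_lhs => rw [← sum_homogeneousComponent h, Finset.sum_mul, map_sum]
  simp only [hterm, Finset.sum_ite_eq']
  split_ifs with hk
  · rfl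
  · have hlt : h.totalDegree < k := by
      rw [Finset.mem_range] at hk
      omega
    rw [homogeneousComponent_eq_zero _ _ hlt, zero_mul]

/-- A substitution `aeval g` in which every variable goes to a polynomial of total degree `≤ 1`
does not raise total degrees. -/
private theorem certWindowQP_totalDegree_aeval_le (g : σ → MvPolynomial τ R)
    (hg : ∀ v, (g v).totalDegree ≤ 1) (p : MvPolynomial σ R) :
    (aeval g p).totalDegree ≤ p.totalDegree := by
  classical
  conv_lhs => rw [p.as_sum, map_sum]
  refine totalDegree_finsetSum_le fun d hd => ?_
  rw [aeval_monomial, algebraMap_eq, Finsupp.prod]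
  refine (totalDegree_mul _ _).trans ?_
  rw [totalDegree_C, zero_add]
  refine (totalDegree_finsetProd _ _).trans
    (le_trans (Finset.sum_le_sum fun i _ => ?_) (le_totalDegree hd))
  exact (totalDegree_pow _ _).trans ((Nat.mul_le_mul_left _ (hg i)).trans (mul_one _).le)

end Helpers

/-- **From ideal membership to a Nullstellensatz refutation (family form).** Let `P i` be
homogeneous polynomials of degree `m` in the variables `τ` (`#τ = N`), `c i` constants, and
`G i := rename some (P i) - C (c i) * T ^ m` their homogenisations (`T = X none`). If
`(T^m)^(N+1)` lies in the ideal spanned by the `G i`, then the system `{P i - C (c i) = 0}` has a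
Nullstellensatz refutation with every product of total degree `≤ (N+1)·m`: take homogeneous
components of degree `mN + m` in `∑ H_i G_i = T^(mN+m)` and substitute `T ↦ 1`. -/
theorem certWindowQP_nsOfPowMem_family {ι τ K : Type*} [CommRing K] [Nontrivial K] [Fintype τ]
    (P : ι → MvPolynomial τ K) (c : ι → K) (m : ℕ)
    (hhom : ∀ i, (P i).IsHomogeneous m)
    (hmem : (((X none : MvPolynomial (Option τ) K) ^ m) ^ Fintype.card (Option τ)) ∈
      Ideal.span (Set.range fun i => rename some (P i) - C (c i) * X none ^ m)) :
    HasNSRefutationOfDegree (fun i => P i - C (c i)) ((Fintype.card τ + 1) * m) := by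
  classical
  -- the homogenised axioms are homogeneous of degree `m`
  have hGhom : ∀ i, (rename some (P i) - C (c i) * (X none : MvPolynomial (Option τ) K) ^ m)
      |>.IsHomogeneous m :=
    fun i => ((hhom i).rename_isHomogeneous).sub (isHomogeneous_C_mul_X_pow (c i) none m)
  -- (1) unpack the membership
  rw [Fintype.card_option, ← pow_mul, mul_add_one] at hmem
  obtain ⟨H, hH⟩ := Finsupp.mem_ideal_span_range_iff_exists_finsupp.mp hmem
  -- (2) homogeneous components of degree `m * N + m`
  have key : ∑ i ∈ H.support, homogeneousComponent (m * Fintype.card τ) (H i) *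
      (rename some (P i) - C (c i) * X none ^ m) =
        (X none : MvPolynomial (Option τ) K) ^ (m * Fintype.card τ + m) := by
    have h2 := congrArg (homogeneousComponent (m * Fintype.card τ + m)) hH
    rw [homogeneousComponent_eq_self (isHomogeneous_X_pow _ _), Finsupp.sum, map_sum] at h2
    simpa only [certWindowQP_homogeneousComponent_mul (hGhom _)] using h2
  -- (3) dehomogenise: `T ↦ 1`, `some v ↦ X v`
  set e : Option τ → MvPolynomial τ K := fun o => o.elim 1 X with he
  have hedeg : ∀ o, (e o).totalDegree ≤ 1 := fun o => by cases o <;> simp [he]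
  have heT : aeval e (X none : MvPolynomial (Option τ) K) = 1 := by simp [he]
  have her : ∀ q : MvPolynomial τ K, aeval e (rename some q) = q := fun q => by
    rw [aeval_rename, he]
    exact aeval_X_left_apply q
  have heG : ∀ i, aeval e (rename some (P i) - C (c i) * (X none : MvPolynomial (Option τ) K) ^ m)
      = P i - C (c i) := fun i => by
    rw [map_sub, map_mul, map_pow, her, heT, aeval_C, algebraMap_eq, one_pow, mul_one]
  refine ⟨H.support, fun i => aeval e (homogeneousComponent (m * Fintype.card τ) (H i)), ?_, ?_⟩
  · have h3 := congrArg (aeval e) key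
    rw [map_sum, map_pow, heT, one_pow] at h3
    simpa only [map_mul, heG] using h3
  · intro i _
    refine (totalDegree_mul _ _).trans ?_
    have h1 : (aeval e (homogeneousComponent (m * Fintype.card τ) (H i))).totalDegree ≤
        m * Fintype.card τ :=
      (certWindowQP_totalDegree_aeval_le e hedeg _).trans
        (homogeneousComponent_isHomogeneous _ _).totalDegree_le
    have h2 : (P i - C (c i)).totalDegree ≤ m :=
      (totalDegree_sub _ _).trans (max_le (hhom i).totalDegree_le (by simp))
    calc _ ≤ m * Fintype.card τ + m := add_le_add h1 h2
      _ = (Fintype.card τ + 1) * m := by ring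

/-- **From ideal membership to a Nullstellensatz refutation (coefficient form).** For
`P : (K[τ])[σ]` with every `σ`-coefficient homogeneous of degree `m` and `p : K[σ]`: if
`(T^m)^(#τ+1)` lies in the ideal spanned by the homogenised coefficients
`rename some (coeff μ P) - C (coeff μ p) * T^m`, then the system of `σ`-coefficients of
`P - map C p` has a Nullstellensatz refutation with every product of total degree `≤ (#τ+1)·m`. -/
theorem certWindowQP_nsOfPowMem {σ τ K : Type*} [CommRing K] [Nontrivial K] [Fintype τ] (m : ℕ)
    (P : MvPolynomial σ (MvPolynomial τ K)) (p : MvPolynomial σ K)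
    (hhom : ∀ μ : σ →₀ ℕ, (MvPolynomial.coeff μ P).IsHomogeneous m)
    (hmem : (((MvPolynomial.X none : MvPolynomial (Option τ) K) ^ m) ^ Fintype.card (Option τ)) ∈
      Ideal.span (Set.range fun μ : σ →₀ ℕ => MvPolynomial.rename some (MvPolynomial.coeff μ P) -
        MvPolynomial.C (MvPolynomial.coeff μ p) * MvPolynomial.X none ^ m)) :
    HasNSRefutationOfDegree (fun μ : σ →₀ ℕ => (P - MvPolynomial.map MvPolynomial.C p).coeff μ)
      ((Fintype.card τ + 1) * (0 + m)) := by
  have hfam : (fun μ : σ →₀ ℕ => (P - MvPolynomial.map MvPolynomial.C p).coeff μ) =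
      fun μ => MvPolynomial.coeff μ P - MvPolynomial.C (MvPolynomial.coeff μ p) := by
    funext μ
    rw [coeff_sub, coeff_map]
  rw [hfam, zero_add]
  exact certWindowQP_nsOfPowMem_family (fun μ => MvPolynomial.coeff μ P)
    (fun μ => MvPolynomial.coeff μ p) m hhom hmem

/-- **Registered stub `stub_nsOfPowMem`** of line `Sketch` (v2, crux `CertWindowQP`,
stmt-ValiantsHypothesis-5640), verbatim signature of the registered skeleton: if
`(T^m)^{N+1} ∈ (G_μ)_μ` (`N+1 = #(unknowns) + 1`, `G_μ = P_μ - c_μ T^m` homogeneous of degree `m`),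
then taking the degree-`m(N+1)` homogeneous component of an identity `∑ H_μ G_μ = T^{m(N+1)}` and
setting `T = 1` gives `∑ h_μ · coeff_μ P = 1` with every product of degree `≤ mN + m`; proved by
`certWindowQP_nsOfPowMem`. (The hypothesis `hhom` is supplied by `stub_coeffHomog`, `hmem` by the
Briançon–Skoda step.) -/
theorem stub_nsOfPowMem (n m : ℕ)
    (hhom : ∀ μ : (Fin n × Fin n) →₀ ℕ, (MvPolynomial.coeff μ (Matrix.of fun i j : Fin m => MvPolynomial.C (MvPolynomial.X (none, (i, j))) + ∑ e : Fin n × Fin n, MvPolynomial.X e * MvPolynomial.C (MvPolynomial.X (some e, (i, j))) : Matrix (Fin m) (Fin m) (MvPolynomial (Fin n × Fin n) (MvPolynomial (Option (Fin n × Fin n) × (Fin m × Fin m)) ℂ))).det).IsHomogeneous m)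
    (hmem : (((MvPolynomial.X none : MvPolynomial (Option (Option (Fin n × Fin n) × (Fin m × Fin m))) ℂ) ^ m) ^
        Fintype.card (Option (Option (Fin n × Fin n) × (Fin m × Fin m)))) ∈
      Ideal.span (Set.range fun μ : (Fin n × Fin n) →₀ ℕ => MvPolynomial.rename some (MvPolynomial.coeff μ (Matrix.of fun i j : Fin m => MvPolynomial.C (MvPolynomial.X (none, (i, j))) + ∑ e : Fin n × Fin n, MvPolynomial.X e * MvPolynomial.C (MvPolynomial.X (some e, (i, j))) : Matrix (Fin m) (Fin m) (MvPolynomial (Fin n × Fin n) (MvPolynomial (Option (Fin n × Fin n) × (Fin m × Fin m)) ℂ))).det) - MvPolynomial.C (MvPolynomial.coeff μ (perPoly (Fin n) ℂ)) * MvPolynomial.X none ^ m)) :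
    HasNSRefutationOfDegree (fun μ : (Fin n × Fin n) →₀ ℕ => ((Matrix.of fun i j : Fin m => MvPolynomial.C (MvPolynomial.X (none, (i, j))) + ∑ e : Fin n × Fin n, MvPolynomial.X e * MvPolynomial.C (MvPolynomial.X (some e, (i, j))) : Matrix (Fin m) (Fin m) (MvPolynomial (Fin n × Fin n) (MvPolynomial (Option (Fin n × Fin n) × (Fin m × Fin m)) ℂ))).det - MvPolynomial.map MvPolynomial.C (Literature.Computability.AlgebraicComplexity.perPoly (Fin n) ℂ)).coeff μ) ((Fintype.card (Option (Fin n × Fin n) × (Fin m × Fin m)) + 1) * (0 + m)) :=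
  certWindowQP_nsOfPowMem m _ _ hhom hmem

end Summit.ValiantsHypothesis.ValiantsHypothesis.Theorems
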